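import Mathlib
import Summits.NavierStokesRegularity.NavierStokesRegularity.Theorems.EulerZoomLiouvillePowerGaugeEulerLiouvilleCondenserLogMeanSquare

/-!
# t54-CAP (1): THE ONE-DIMENSIONAL HARDY INEQUALITY WITH END-POINT TERM (LEAD 19832 g15; nsreg-p2 ROUND-51 `IntervalHardy`, text VERBATIM)

Class-free tool for crux `EulerZoomLiouville.PowerGaugeEulerLiouville` (stmt-NavierStokesRegularity-19832), LEAD ns-typeII-p2 g15,
`--supports stmt-NavierStokesRegularity-19832 --as helper`.  nsreg-p2 g41's ROUND-51 «THE CAPS COME FOR FREE» §1 (`r51/Sketch51.lean` 3a26356e4f98d965,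
Prop `NsregP2.R51.IntervalHardy`): for `C¹` `g` and `T > 0`, `∫₀ᵀ g² ≤ 2T·g(T)² + 2T·∫₀ᵀ t·g′(t)²` — the 2-D cap energy controls every end-disc functional of the
axis law up to the wall value (ray by ray; the three ray/disc corollaries `EndFluxHardy` / `AxialRayHardy` / `RadialRayHardy` and `CapCostBound` are t54-CAP (2)/t54-CC).
Proof (elementary): `g(t) = g(T) − ∫_tᵀ g′`, weighted Cauchy–Schwarz `(∫_tᵀ g′)² ≤ (∫_tᵀ ds/s)(∫_tᵀ s g′²) = log(T/t)·∫_tᵀ s g′²`, and `∫₀ᵀ log(T/t) dt = T`.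

* `intervalHardy_of_hasDerivAt` — the statement for `g` with a continuous derivative `g′` given as a function;
* `intervalHardy : <NsregP2.R51.IntervalHardy VERBATIM>` (`ContDiff ℝ 1 g`, `deriv g`).

HONEST FRAMING: 1-D calculus; nothing about the crux E (19832 OPEN), Euler profiles or Navier–Stokes regularity is proved here.
[Kufner–Persson 2003 (7.29) for the sharp constants; folklore]
-/

noncomputable section

open Set Filter Topology Metric Function MeasureTheory Real
open scoped Interval

set_option linter.dupNamespace false

namespace Summit.NavierStokesRegularity.NavierStokesRegularity.Theorems.PowerGaugeEulerLiouville.HoopCore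

/-- **HARDY WITH END-POINT TERM** (derivative as a function): `g` differentiable with continuous derivative `g′`, `T > 0` ⇒
`∫₀ᵀ g² ≤ 2T·g(T)² + 2T·∫₀ᵀ t·g′(t)²`. [folklore; Kufner–Persson 2003 (7.29)] -/
theorem intervalHardy_of_hasDerivAt {g g' : ℝ → ℝ} {T : ℝ} (hT : 0 < T) (hg : ∀ x, HasDerivAt g (g' x) x)
    (hg' : Continuous g') :
    ∫ t in (0 : ℝ)..T, g t ^ 2 ≤ 2 * T * g T ^ 2 + 2 * T * ∫ t in (0 : ℝ)..T, t * g' t ^ 2 := by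
  have hgc : Continuous g := continuous_iff_continuousAt.2 fun x => (hg x).continuousAt
  set K : ℝ := ∫ s in (0 : ℝ)..T, s * g' s ^ 2 with hK
  have hK0 : 0 ≤ K := intervalIntegral.integral_nonneg hT.le fun s hs => by
    have : 0 ≤ s := hs.1
    positivity
  have hwc : Continuous fun s => s * g' s ^ 2 := continuous_id.mul (hg'.pow 2)
  -- pointwise bound on `(0, T)`
  have hpt : ∀ t ∈ Ioo 0 T, g t ^ 2 ≤ 2 * g T ^ 2 + 2 * Real.log (T / t) * K := by
    intro t ht
    have ht0 : 0 < t := ht.1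
    have htT : t ≤ T := ht.2.le
    -- FTC on `[t, T]`
    have hFTC : ∫ s in t..T, g' s = g T - g t :=
      intervalIntegral.integral_eq_sub_of_hasDerivAt (fun x _ => hg x) (hg'.intervalIntegrable _ _)
    -- weighted Cauchy–Schwarz on `[t, T]`
    have hfc : ContinuousOn (fun s => (Real.sqrt s)⁻¹) (uIcc t T) := by
      refine ContinuousOn.inv₀ (Real.continuous_sqrt.continuousOn) fun s hs => ?_
      rw [uIcc_of_le htT] at hs
      exact (Real.sqrt_pos.2 (lt_of_lt_of_le ht0 hs.1)).ne'
    have hf2 : IntervalIntegrable (fun s => ((Real.sqrt s)⁻¹) ^ 2) volume t T := (hfc.pow 2).intervalIntegrable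
    have hg2 : IntervalIntegrable (fun s => (Real.sqrt s * g' s) ^ 2) volume t T :=
      ((Real.continuous_sqrt.mul hg').pow 2).intervalIntegrable _ _
    have hfg : IntervalIntegrable (fun s => (Real.sqrt s)⁻¹ * (Real.sqrt s * g' s)) volume t T :=
      (hfc.mul ((Real.continuous_sqrt.mul hg').continuousOn)).intervalIntegrable
    have hCS := Condenser.sq_integral_mul_le_of_intervalIntegrable htT hf2 hg2 hfg
    -- identify the three integrals
    have e1 : ∫ s in t..T, (Real.sqrt s)⁻¹ * (Real.sqrt s * g' s) = ∫ s in t..T, g' s := by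
      refine intervalIntegral.integral_congr fun s hs => ?_
      rw [uIcc_of_le htT] at hs
      have hs0 : 0 < Real.sqrt s := Real.sqrt_pos.2 (lt_of_lt_of_le ht0 hs.1)
      field_simp
    have e2 : ∫ s in t..T, ((Real.sqrt s)⁻¹) ^ 2 = Real.log (T / t) := by
      rw [← integral_inv_of_pos ht0 hT]
      refine intervalIntegral.integral_congr fun s hs => ?_
      rw [uIcc_of_le htT] at hs
      have hs0 : 0 ≤ s := ht0.le.trans hs.1
      rw [inv_pow, Real.sq_sqrt hs0]
    have e3 : ∫ s in t..T, (Real.sqrt s * g' s) ^ 2 = ∫ s in t..T, s * g' s ^ 2 := by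
      refine intervalIntegral.integral_congr fun s hs => ?_
      rw [uIcc_of_le htT] at hs
      have hs0 : 0 ≤ s := ht0.le.trans hs.1
      rw [mul_pow, Real.sq_sqrt hs0]
    have e4 : ∫ s in t..T, s * g' s ^ 2 ≤ K :=
      intervalIntegral.integral_mono_interval ht0.le htT le_rfl
        ((ae_restrict_iff' measurableSet_Ioc).2 (ae_of_all _ fun s hs => by
          have : 0 ≤ s := hs.1.le
          positivity))
        (hwc.intervalIntegrable _ _)
    rw [e1, e2, e3, hFTC] at hCS
    have hlog : 0 ≤ Real.log (T / t) := Real.log_nonneg ((one_le_div ht0).2 htT)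
    have hI : (g T - g t) ^ 2 ≤ Real.log (T / t) * K :=
      hCS.trans (mul_le_mul_of_nonneg_left e4 hlog)
    nlinarith [hI, sq_nonneg (2 * g T - g t), hlog, hK0]
  -- integrate the pointwise bound over `(0, T)`
  have hlogT : ∫ t in (0 : ℝ)..T, Real.log (T / t) = T := by
    have e : ∫ t in (0 : ℝ)..T, Real.log (T / t) = ∫ t in (0 : ℝ)..T, (Real.log T - Real.log t) := by
      refine intervalIntegral.integral_congr_ae (ae_of_all _ fun t ht => ?_)
      rw [uIoc_of_le hT.le] at ht
      rw [Real.log_div hT.ne' ht.1.ne']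
    rw [e, intervalIntegral.integral_sub intervalIntegrable_const intervalIntegral.intervalIntegrable_log', intervalIntegral.integral_const,
      integral_log, smul_eq_mul]
    simp
  have hIlog : IntervalIntegrable (fun t => Real.log (T / t)) volume 0 T := by
    have h0 : IntervalIntegrable (fun t => Real.log T - Real.log t) volume 0 T :=
      intervalIntegrable_const.sub intervalIntegral.intervalIntegrable_log'
    refine h0.congr fun t ht => ?_
    rw [uIoc_of_le hT.le] at ht
    show Real.log T - Real.log t = Real.log (T / t)
    rw [Real.log_div hT.ne' ht.1.ne']
  have hIrhs : IntervalIntegrable (fun t => 2 * g T ^ 2 + 2 * Real.log (T / t) * K) volume 0 T :=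
    intervalIntegrable_const.add ((hIlog.const_mul 2).mul_const K)
  have hmono := intervalIntegral.integral_mono_on_of_le_Ioo hT.le ((hgc.pow 2).intervalIntegrable _ _) hIrhs hpt
  have hrhs : ∫ t in (0 : ℝ)..T, (2 * g T ^ 2 + 2 * Real.log (T / t) * K) = 2 * T * g T ^ 2 + 2 * T * K := by
    rw [intervalIntegral.integral_add intervalIntegrable_const ((hIlog.const_mul 2).mul_const K),
      intervalIntegral.integral_const, intervalIntegral.integral_mul_const, intervalIntegral.integral_const_mul, hlogT,
      smul_eq_mul]
    ring
  rw [hrhs] at hmono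
  exact hmono

/-- **ONE-DIMENSIONAL HARDY INEQUALITY WITH END-POINT TERM** — nsreg-p2 ROUND-51 `IntervalHardy`, text VERBATIM (`r51/Sketch51.lean` 3a26356e4f98d965):
for `C¹` `g` and `T > 0`, `∫₀ᵀ g² ≤ 2T·g(T)² + 2T·∫₀ᵀ t·g′(t)²`. [Kufner–Persson 2003 (7.29); folklore] -/
theorem intervalHardy :
    ∀ (g : ℝ → ℝ) (T : ℝ), 0 < T → ContDiff ℝ 1 g →
      ∫ t in (0 : ℝ)..T, g t ^ 2 ≤ 2 * T * g T ^ 2 + 2 * T * ∫ t in (0 : ℝ)..T, t * deriv g t ^ 2 := by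
  intro g T hT hg
  exact intervalHardy_of_hasDerivAt hT (fun x => (hg.differentiable one_ne_zero x).hasDerivAt) (hg.continuous_deriv le_rfl)

end Summit.NavierStokesRegularity.NavierStokesRegularity.Theorems.PowerGaugeEulerLiouville.HoopCore

end
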